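import Summits.CriticalPhenomena.PercolationContinuityZ3.Theses.PercNearOneGluing
import Literature.Probability.Percolation.PercolationEvents
import HarnessLib.Audit
import Literature.Probability.LatticeModels.ProdBernoulliIndependence
import Summits.CriticalPhenomena.PercolationContinuityZ3.Theorems.PercNearOneGluingAdditiveGluingOneBond
import Summits.CriticalPhenomena.PercolationContinuityZ3.Theorems.PercNearOneGluingAdditiveGluingKnLemma3Mixed
import Summits.CriticalPhenomena.PercolationContinuityZ3.Theorems.PercNearOneGluingNearOneGluingPivotalityDomination

/-! TTRL-lite variant V2525 of stmt-CriticalPhenomena-4574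

(`stub_shorteningStep` of line `kn_shortening_induction`, move `small_case+small_case`:
`n ≤ 5` and `A.card = 3`).  Kozma–Nitzan's SHORTENING STEP (arXiv:2401.12397, Conjecture 6, p. 34)
against the OLD minimiser `a₀`, for three relays on at most five vertices — proved outright (the
displayed induction hypothesis is not used).

Write `μ = prodBernoulli w`, `μ₁ = prodBernoulli (w[s(v,x) ↦ 1])`, `V = {v, x}`,
`{V ↔ z} = {v ↔ z} ∪ {x ↔ z}`.  The argument of the sibling variant V2415 (`|A| ≤ 2`) is run with an
auxiliary relay `a₁ ∈ A`:
* Transport (`goodStepEI_prodBernoulli_map_insert`, `pivDom_reachable_insert`):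
  `μ₁(v ↔ A) ≤ μ(E)` with `E = ⋃_{a ∈ A} {V ↔ a}`, `μ₁(a₀ ↔ b) ≤ μ(K)` with
  `K = {a₀ ↔ b} ∪ ({a₀ ↔ v} ∩ {x ↔ b}) ∪ ({a₀ ↔ x} ∩ {v ↔ b})`, and `μ(V ↔ b) ≤ μ₁(v ↔ b)`.
* Harris (`prodBernoulli_harris`): `μ(E) μ(K) ≤ μ(E ∩ K)`.
* Event algebra: with `T = {a₀ ↔ V}`, `Q = {V ↔ a₁} ∩ {V ↮ a₀}` and the exceptional event
  `Z = {b = a₀} ∩ ⋃_{a ∈ A} {a ↮ a₀}` one has `E ∩ K ⊆ (({V ↔ b} ∩ T) ∪ ({a₀ ↔ b} ∩ Q)) ∪ Z`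
  PROVIDED every relay `a ∈ A` satisfies
  `a = a₀ ∨ a = a₁ ∨ a = b ∨ x = a₁ ∨ x = a₀ ∨ b = v ∨ b = x ∨ b = a₀`
  (on `¬T` the event `K` forces `a₀ ↔ b`, which is absurd if `b ∈ V` or if `V ↔ b`; `x = a₀`
  contradicts `¬T`; `x = a₁` makes `V ↔ a₁` trivial).
* `μ(Z) = 0`: if `b = a₀` the minimiser hypothesis reads `1 = μ(a₀ ↔ a₀) ≤ μ(a ↔ a₀)`.
* Kozma–Nitzan Lemma 3 for the mixed-monotone event `Q` (`knLemma3Mixed_setObserver_star`, from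
  van den Berg–Häggström–Kahn), fed by `μ(a₀ ↔ b) ≤ μ(a₁ ↔ b)`:
  `μ({a₀ ↔ b} ∩ Q) ≤ μ({V ↔ b} ∩ Q) ≤ μ({V ↔ b} ∖ T)`.
Adding up, `μ₁(v ↔ A) μ₁(a₀ ↔ b) ≤ μ(E ∩ K) ≤ μ(V ↔ b) ≤ μ₁(v ↔ b)`.
* Combinatorics (`A.card = 3`, `n ≤ 5`, `v ∉ A`): write `A = {a₀, p, q}`; if `x ∈ {p, q}` take
  `a₁ = x`, if `b ∈ {p, q}` take `a₁` the other one, if `x = a₀` anything; otherwise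
  `v, x, a₀, p, q` are five distinct vertices, i.e. all of `Fin n`, so `b ∈ {v, x, a₀}`.
No new definitions, no named facts. -/

namespace Summit.CriticalPhenomena.PercolationContinuityZ3.Theorems

open MeasureTheory Set Literature.Probability.LatticeModels Literature.Probability.Percolation
open scoped Classical BigOperators

/-- TTRL-lite variant V2525 of `stub_shorteningStep` (stmt-CriticalPhenomena-4574): Kozma–Nitzan's
shortening step (Conjecture 6 of arXiv:2401.12397, measured against the minimiser `a₀` of the
uncontracted graph) for `A.card = 3` relays on `n ≤ 5` vertices.  Proof: transport the three glued
probabilities to the uncontracted measure along `ω ↦ insert s(v,x) ω`, Harris, and Kozma–Nitzan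
Lemma 3 for the mixed-monotone set-observer event `{V ↔ a₁} ∩ {V ↮ a₀}`, `V = {v, x}`
(`knLemma3Mixed_setObserver_star`), for an auxiliary relay `a₁ ∈ A` chosen so that every relay is
one of `a₀, a₁, b`, or `a₁ = x`, or the configuration is degenerate (`x = a₀`, `b ∈ {v, x}`), or
`b = a₀` (where the leftover event is null by the minimiser hypothesis); such an `a₁` exists by
counting, since `v, x, a₀` and the two other relays cannot be five distinct vertices avoiding `b`. -/
theorem stub_shorteningStep_var2525 : ∀ (n : ℕ) (w : Sym2 (Fin n) → unitInterval) (A : Finset (Fin n)) (b v x a₀ : Fin n), n ≤ 5 → A.card = 3 → v ∉ A → v ≠ x → w s(v, x) = 0 → a₀ ∈ A → (∀ a ∈ A, (prodBernoulli w).real (openConn a₀ b) ≤ (prodBernoulli w).real (openConn a b)) → (∀ w' : Sym2 (Fin n) → unitInterval, (∀ e, w e = 0 → w' e = 0) → ∀ (A' : Finset (Fin n)) (o' b' : Fin n) (t : ℝ), (∀ a ∈ A', t ≤ (prodBernoulli w').real (openConn a b')) → (prodBernoulli w').real (⋃ a ∈ A', openConn o' a) * t ≤ (prodBernoulli w').real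 (openConn o' b')) → (prodBernoulli (Function.update w s(v, x) 1)).real (⋃ a ∈ A, openConn v a) * (prodBernoulli (Function.update w s(v, x) 1)).real (openConn a₀ b) ≤ (prodBernoulli (Function.update w s(v, x) 1)).real (openConn v b) := by
  intro n w A b v x a₀ hn hcard hvA hvx _hw0 ha₀ hmin _hIH
  -- (0) the two relays other than `a₀`
  obtain ⟨p, q, hpq, hApq⟩ : ∃ p q : Fin n, p ≠ q ∧ A.erase a₀ = {p, q} :=
    Finset.card_eq_two.1 (by rw [Finset.card_erase_of_mem ha₀, hcard])
  have hp : p ∈ A.erase a₀ := by rw [hApq]; simp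
  have hq : q ∈ A.erase a₀ := by rw [hApq]; simp
  have hpA : p ∈ A := (Finset.mem_erase.1 hp).2
  have hpa₀ : p ≠ a₀ := (Finset.mem_erase.1 hp).1
  have hqA : q ∈ A := (Finset.mem_erase.1 hq).2
  have hqa₀ : q ≠ a₀ := (Finset.mem_erase.1 hq).1
  have hA3 : ∀ a ∈ A, a = a₀ ∨ a = p ∨ a = q := by
    intro a ha
    by_cases h : a = a₀
    · exact Or.inl h
    · have h' : a ∈ A.erase a₀ := Finset.mem_erase.2 ⟨h, ha⟩
      rw [hApq, Finset.mem_insert, Finset.mem_singleton] at h'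
      exact Or.inr h'
  -- (1) the auxiliary relay `a₁`
  obtain ⟨a₁, ha₁, hH⟩ : ∃ a₁ ∈ A, ∀ a ∈ A,
      a = a₀ ∨ a = a₁ ∨ a = b ∨ x = a₁ ∨ x = a₀ ∨ b = v ∨ b = x ∨ b = a₀ := by
    by_cases hxp : x = p
    · exact ⟨p, hpA, fun a _ => Or.inr (Or.inr (Or.inr (Or.inl hxp)))⟩
    by_cases hxq : x = q
    · exact ⟨q, hqA, fun a _ => Or.inr (Or.inr (Or.inr (Or.inl hxq)))⟩
    by_cases hbp : b = p
    · refine ⟨q, hqA, fun a ha => ?_⟩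
      rcases hA3 a ha with h | h | h
      · exact Or.inl h
      · exact Or.inr (Or.inr (Or.inl (h.trans hbp.symm)))
      · exact Or.inr (Or.inl h)
    by_cases hbq : b = q
    · refine ⟨p, hpA, fun a ha => ?_⟩
      rcases hA3 a ha with h | h | h
      · exact Or.inl h
      · exact Or.inr (Or.inl h)
      · exact Or.inr (Or.inr (Or.inl (h.trans hbq.symm)))
    by_cases hxa : x = a₀
    · exact ⟨a₀, ha₀, fun a _ => Or.inr (Or.inr (Or.inr (Or.inr (Or.inl hxa))))⟩
    -- otherwise `v, x, a₀, p, q` are five distinct vertices, hence all of `Fin n`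
    have hva₀ : v ≠ a₀ := fun h => hvA (h ▸ ha₀)
    have hvp : v ≠ p := fun h => hvA (h ▸ hpA)
    have hvq : v ≠ q := fun h => hvA (h ▸ hqA)
    have h2 : ({p, q} : Finset (Fin n)).card = 2 := Finset.card_pair hpq
    have h3 : a₀ ∉ ({p, q} : Finset (Fin n)) := by
      simp only [Finset.mem_insert, Finset.mem_singleton, not_or]
      exact ⟨hpa₀.symm, hqa₀.symm⟩
    have h4 : x ∉ ({a₀, p, q} : Finset (Fin n)) := by
      simp only [Finset.mem_insert, Finset.mem_singleton, not_or]
      exact ⟨hxa, hxp, hxq⟩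
    have h5 : v ∉ ({x, a₀, p, q} : Finset (Fin n)) := by
      simp only [Finset.mem_insert, Finset.mem_singleton, not_or]
      exact ⟨hvx, hva₀, hvp, hvq⟩
    have hS5 : ({v, x, a₀, p, q} : Finset (Fin n)).card = 5 := by
      rw [Finset.card_insert_of_notMem h5, Finset.card_insert_of_notMem h4,
        Finset.card_insert_of_notMem h3, h2]
    have hle : ({v, x, a₀, p, q} : Finset (Fin n)).card ≤ n := by
      calc ({v, x, a₀, p, q} : Finset (Fin n)).card ≤ Fintype.card (Fin n) :=
            Finset.card_le_univ _
        _ = n := Fintype.card_fin n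
    have hSuniv : ({v, x, a₀, p, q} : Finset (Fin n)) = Finset.univ :=
      Finset.eq_univ_of_card _ (by rw [hS5, Fintype.card_fin]; omega)
    have hb : b ∈ ({v, x, a₀, p, q} : Finset (Fin n)) := by
      rw [hSuniv]; exact Finset.mem_univ b
    simp only [Finset.mem_insert, Finset.mem_singleton] at hb
    refine ⟨a₀, ha₀, fun a _ => ?_⟩
    rcases hb with hb | hb | hb | hb | hb
    · exact Or.inr (Or.inr (Or.inr (Or.inr (Or.inr (Or.inl hb)))))
    · exact Or.inr (Or.inr (Or.inr (Or.inr (Or.inr (Or.inr (Or.inl hb))))))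
    · exact Or.inr (Or.inr (Or.inr (Or.inr (Or.inr (Or.inr (Or.inr hb))))))
    · exact absurd hb hbp
    · exact absurd hb hbq
  -- every event is measurable on the finite configuration space
  have hmeas : ∀ S : Set (BondConfig (Fin n)), MeasurableSet S := fun S =>
    MeasurableSet.of_discrete
  -- transport along `ω ↦ insert s(v,x) ω`, whose image measure is the glued measure
  have hmi : Measurable fun ω : BondConfig (Fin n) => insert s(v, x) ω := by
    refine measurable_set_iff.2 fun i => ?_
    simp only [Set.mem_insert_iff]
    exact measurable_const.or (measurable_set_mem i)
  have htrans : ∀ F : Set (BondConfig (Fin n)),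
      (prodBernoulli (Function.update w s(v, x) 1)).real F =
        (prodBernoulli w).real ((fun ω : BondConfig (Fin n) => insert s(v, x) ω) ⁻¹' F) := by
    intro F
    rw [← goodStepEI_prodBernoulli_map_insert w s(v, x), map_measureReal_apply hmi (hmeas F)]
  -- the events of the uncontracted graph (`V = {v, x}`)
  set Fb : Set (BondConfig (Fin n)) := openConn v b ∪ openConn x b with hFb
  set E : Set (BondConfig (Fin n)) :=
    {ω | ∃ a ∈ A, (openGraph ω).Reachable v a ∨ (openGraph ω).Reachable x a} with hE
  set K : Set (BondConfig (Fin n)) :=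
    openConn a₀ b ∪ ((openConn a₀ v ∩ openConn x b) ∪ (openConn a₀ x ∩ openConn v b)) with hK
  set T : Set (BondConfig (Fin n)) := openConn a₀ v ∪ openConn a₀ x with hT
  set Q : Set (BondConfig (Fin n)) :=
    {ω | (∃ y ∈ ({v, x} : Finset (Fin n)), (openGraph ω).Reachable a₁ y) ∧
      ∀ y ∈ ({v, x} : Finset (Fin n)), ¬ (openGraph ω).Reachable a₀ y} with hQ
  set Sb : Set (BondConfig (Fin n)) :=
    {ω | ∃ y ∈ ({v, x} : Finset (Fin n)), (openGraph ω).Reachable y b} with hSb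
  set Z : Set (BondConfig (Fin n)) :=
    {ω | b = a₀ ∧ ∃ a ∈ A, ¬ (openGraph ω).Reachable a a₀} with hZ
  -- (2) the three transports
  have hX : (prodBernoulli w).real Fb ≤
      (prodBernoulli (Function.update w s(v, x) 1)).real (openConn v b) := by
    rw [htrans]
    refine measureReal_mono (fun ω hω => ?_)
    rcases hω with h | h
    · exact (h : (openGraph ω).Reachable v b).mono (openGraph_mono (Set.subset_insert _ _))
    · exact pivDom_reachable_insert_of ω hvx h
  have hY : (prodBernoulli (Function.update w s(v, x) 1)).real (⋃ a ∈ A, openConn v a) ≤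
      (prodBernoulli w).real E := by
    rw [htrans]
    refine measureReal_mono (fun ω hω => ?_)
    simp only [Set.mem_preimage, Set.mem_iUnion, exists_prop] at hω
    obtain ⟨a, ha, h⟩ := hω
    refine ⟨a, ha, ?_⟩
    rcases pivDom_reachable_insert ω v x v a h with h1 | ⟨-, h1⟩ | ⟨-, h1⟩
    exacts [Or.inl h1, Or.inr h1, Or.inl h1]
  have hKt : (prodBernoulli (Function.update w s(v, x) 1)).real (openConn a₀ b) ≤
      (prodBernoulli w).real K := by
    rw [htrans]
    refine measureReal_mono (fun ω hω => ?_)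
    rcases pivDom_reachable_insert ω v x a₀ b hω with h1 | ⟨h1, h2⟩ | ⟨h1, h2⟩
    exacts [Or.inl h1, Or.inr (Or.inl ⟨h1, h2⟩), Or.inr (Or.inr ⟨h1, h2⟩)]
  -- (3) Harris for the increasing events `E`, `K`
  have hEup : IsUpperSet E := by
    intro ω ω' hle hω
    obtain ⟨a, ha, h⟩ := hω
    refine ⟨a, ha, ?_⟩
    rcases h with h | h
    · exact Or.inl (h.mono (openGraph_mono hle))
    · exact Or.inr (h.mono (openGraph_mono hle))
  have hKup : IsUpperSet K :=
    (isUpperSet_openConn a₀ b).union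
      (((isUpperSet_openConn a₀ v).inter (isUpperSet_openConn x b)).union
        ((isUpperSet_openConn a₀ x).inter (isUpperSet_openConn v b)))
  have hHarris : (prodBernoulli w).real E * (prodBernoulli w).real K ≤
      (prodBernoulli w).real (E ∩ K) :=
    prodBernoulli_harris w hEup hKup (hmeas _) (hmeas _)
  -- (4) event algebra
  have hsplit : E ∩ K ⊆ ((Fb ∩ T) ∪ (openConn a₀ b ∩ Q)) ∪ Z := by
    rintro ω ⟨hωE, hωK⟩
    by_cases hT' : ω ∈ T
    · refine Or.inl (Or.inl ⟨?_, hT'⟩)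
      rcases hωK with hab | ⟨_, hxb⟩ | ⟨_, hvb⟩
      · rcases hT' with hav | hax
        · exact Or.inl ((SimpleGraph.Reachable.symm hav).trans hab)
        · exact Or.inr ((SimpleGraph.Reachable.symm hax).trans hab)
      · exact Or.inr hxb
      · exact Or.inl hvb
    · have hav : ¬ (openGraph ω).Reachable a₀ v := fun h => hT' (Or.inl h)
      have hax : ¬ (openGraph ω).Reachable a₀ x := fun h => hT' (Or.inr h)
      have hab : (openGraph ω).Reachable a₀ b := by
        rcases hωK with hab | ⟨h, _⟩ | ⟨h, _⟩
        exacts [hab, absurd h hav, absurd h hax]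
      have hno : ∀ y ∈ ({v, x} : Finset (Fin n)), ¬ (openGraph ω).Reachable a₀ y := by
        intro y hy
        simp only [Finset.mem_insert, Finset.mem_singleton] at hy
        rcases hy with hy | hy
        · rw [hy]; exact hav
        · rw [hy]; exact hax
      obtain ⟨a, ha, h⟩ := hωE
      have hVa : ¬ (openGraph ω).Reachable a a₀ := by
        intro haa
        rcases h with h | h
        · exact hav (h.trans haa).symm
        · exact hax (h.trans haa).symm
      rcases hH a ha with h0 | h0 | h0 | h0 | h0 | h0 | h0 | h0
      · -- `a = a₀`
        rw [h0] at hVa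
        exact absurd (SimpleGraph.Reachable.refl a₀) hVa
      · -- `a = a₁`: the set-observer event `Q` holds
        refine Or.inl (Or.inr ⟨hab, ?_, hno⟩)
        rw [h0] at h
        rcases h with h | h
        · exact ⟨v, by simp, h.symm⟩
        · exact ⟨x, by simp, h.symm⟩
      · -- `a = b`: then `a₀ ↔ b ↔ V`, contradicting `¬T`
        rw [h0] at h
        rcases h with h | h
        · exact absurd (hab.trans h.symm) hav
        · exact absurd (hab.trans h.symm) hax
      · -- `x = a₁`: `V ↔ a₁` trivially
        refine Or.inl (Or.inr ⟨hab, ⟨x, by simp, ?_⟩, hno⟩)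
        rw [← h0]
      · -- `x = a₀` contradicts `¬T`
        rw [h0] at hax
        exact absurd (SimpleGraph.Reachable.refl a₀) hax
      · -- `b = v` contradicts `¬T`
        rw [h0] at hab
        exact absurd hab hav
      · -- `b = x` contradicts `¬T`
        rw [h0] at hab
        exact absurd hab hax
      · -- `b = a₀`: exceptional (null) event
        exact Or.inr ⟨h0, a, ha, hVa⟩
  have hSbQ : Sb ∩ Q ⊆ Fb \ T := by
    rintro ω ⟨⟨y, hy, hyb⟩, -, hno⟩
    refine ⟨?_, ?_⟩
    · simp only [Finset.mem_insert, Finset.mem_singleton] at hy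
      rcases hy with hy | hy
      · rw [hy] at hyb; exact Or.inl hyb
      · rw [hy] at hyb; exact Or.inr hyb
    · rintro (h | h)
      · exact hno v (by simp) h
      · exact hno x (by simp) h
  -- (5) Kozma–Nitzan Lemma 3 (mixed, set observer `{v, x}`), fed by the minimiser hypothesis
  have hL3 : (prodBernoulli w).real (openConn a₀ b ∩ Q) ≤ (prodBernoulli w).real (Sb ∩ Q) + 0 :=
    knLemma3Mixed_setObserver_star n w a₀ a₁ b ({v, x} : Finset (Fin n)) 0 le_rfl
      (by rw [add_zero]; exact hmin a₁ ha₁)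
  -- (6) the exceptional event is null
  have hZnull : (prodBernoulli w).real Z = 0 := by
    by_cases hba : b = a₀
    · have hsub : Z ⊆ ⋃ a ∈ A, (openConn a a₀ : Set (BondConfig (Fin n)))ᶜ := by
        rintro ω ⟨-, a, ha, hna⟩
        simp only [Set.mem_iUnion, Set.mem_compl_iff, exists_prop]
        exact ⟨a, ha, hna⟩
      have h0 : ∀ a ∈ A,
          (prodBernoulli w).real (openConn a a₀ : Set (BondConfig (Fin n)))ᶜ = 0 := by
        intro a ha
        have huniv : (openConn a₀ a₀ : Set (BondConfig (Fin n))) = Set.univ := by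
          ext ω
          exact ⟨fun _ => trivial, fun _ => SimpleGraph.Reachable.refl a₀⟩
        have hm := hmin a ha
        rw [hba, huniv, probReal_univ] at hm
        have h1 : (prodBernoulli w).real (openConn a a₀ : Set (BondConfig (Fin n))) = 1 :=
          le_antisymm measureReal_le_one hm
        rw [measureReal_compl (hmeas _), probReal_univ, h1, sub_self]
      refine le_antisymm ?_ measureReal_nonneg
      calc (prodBernoulli w).real Z
          ≤ (prodBernoulli w).real (⋃ a ∈ A, (openConn a a₀ : Set (BondConfig (Fin n)))ᶜ) :=
            measureReal_mono hsub (measure_ne_top _ _)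
        _ ≤ ∑ a ∈ A, (prodBernoulli w).real (openConn a a₀ : Set (BondConfig (Fin n)))ᶜ :=
            measureReal_biUnion_finset_le _ _
        _ = 0 := Finset.sum_eq_zero h0
    · have hZe : Z = ∅ := by
        ext ω
        simp only [hZ, Set.mem_setOf_eq, Set.mem_empty_iff_false, iff_false, not_and]
        exact fun h _ => hba h
      rw [hZe, measureReal_empty]
  -- (7) assemble
  have hFsum : (prodBernoulli w).real (Fb ∩ T) + (prodBernoulli w).real (Fb \ T) =
      (prodBernoulli w).real Fb :=
    measureReal_inter_add_sdiff (hmeas T)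
  have h1 : (prodBernoulli w).real (E ∩ K) ≤
      (prodBernoulli w).real (Fb ∩ T) + (prodBernoulli w).real (openConn a₀ b ∩ Q) +
        (prodBernoulli w).real Z :=
    (measureReal_mono hsplit).trans
      ((measureReal_union_le _ _).trans (add_le_add (measureReal_union_le _ _) le_rfl))
  have h2 : (prodBernoulli w).real (Sb ∩ Q) ≤ (prodBernoulli w).real (Fb \ T) :=
    measureReal_mono hSbQ
  calc (prodBernoulli (Function.update w s(v, x) 1)).real (⋃ a ∈ A, openConn v a) *
        (prodBernoulli (Function.update w s(v, x) 1)).real (openConn a₀ b)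
      ≤ (prodBernoulli w).real E * (prodBernoulli w).real K :=
        mul_le_mul hY hKt measureReal_nonneg measureReal_nonneg
    _ ≤ (prodBernoulli w).real (E ∩ K) := hHarris
    _ ≤ (prodBernoulli w).real Fb := by linarith
    _ ≤ (prodBernoulli (Function.update w s(v, x) 1)).real (openConn v b) := hX

end Summit.CriticalPhenomena.PercolationContinuityZ3.Theorems
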